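import Summits.MatrixMultiplication.OmegaCensus.SmallFormats.MatMul22nRankGF7XCapSystem
import HarnessLib

/-!
# ω-census family (a): core of the `𝔽₇` kernel replay — a passing `BoxCert` certificate for `xcapSys7s s` bounds WLOG-normalised computations

Cell `pub-omega` (unit `pub-omega-tensor-g8`), topic `Summits/MatrixMultiplication/OmegaCensus` (sub-folder `SmallFormats`).
Framing (verbatim): lottery ticket; floor = certified bounds/negative ranges. HONEST FRAMING: glue, conditional on a certificate `c`
with `c.check (xcapSys7s s) D T s [] = true` (supplied by a sibling data file) and on the WLOG inequalities `x_g ≤ x_58` for the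
invertible classes `g` (supplied by one sandwich normalisation); it reads the coefficient matrix off the column lists of
`MatMul22nRankGF7XCapSystem`, turns the cap lemmas of the tree into `BoxCert.System.Feasible` for the class-count vector of the X-forms,
and concludes `|ι| < T` at `|ι| ≤ 3n + s`. Nothing here is progress on `ω`.
-/

namespace Summit.MatrixMultiplication.OmegaCensus.SmallFormats

open Module Matrix Finset Literature.Computability.AlgebraicComplexity
open Summit.MatrixMultiplication.OmegaCensus.RankOnePlaneCapGeneral

/-! ## Reading the coefficient matrix off the column lists -/

/-- The `foldr` in `BoxCert.System.A` is a list sum. -/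
theorem foldr_snd_eq_sum (l : List (ℕ × ℤ)) : l.foldr (fun e acc => e.2 + acc) 0 = (l.map (·.2)).sum := by
  induction l with
  | nil => rfl
  | cons e t ih => simp [List.foldr_cons, ih]

/-- Sum of the second components over the entries `(f g, c)`, `g ∈ l`, whose first component is `r`: for `l` without repetitions
and `f` injective this is `c` or `0` according as `r` is hit. -/
theorem sum_filter_map_pair (l : List ℕ) (hl : l.Nodup) (f : ℕ → ℕ) (hf : Function.Injective f) (c : ℤ) (r : ℕ) :
    (((l.map fun g => (f g, c)).filter fun e => e.1 = r).map (·.2)).sum = if ∃ g ∈ l, f g = r then c else 0 := by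
  induction l with
  | nil => simp
  | cons a t ih =>
    rw [List.nodup_cons] at hl
    obtain ⟨ha, ht⟩ := hl
    specialize ih ht
    by_cases har : f a = r
    · have hnot : ¬ ∃ g ∈ t, f g = r := by
        rintro ⟨g, hg, hfg⟩
        exact ha (by rwa [hf (hfg.trans har.symm)] at hg)
      rw [if_neg hnot] at ih
      have hyes : ∃ g ∈ a :: t, f g = r := ⟨a, by simp, har⟩
      rw [if_pos hyes, List.map_cons, List.filter_cons_of_pos (by simpa using har), List.map_cons, List.sum_cons, ih, add_zero]
    · have hiff : (∃ g ∈ a :: t, f g = r) ↔ ∃ g ∈ t, f g = r := by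
        constructor
        · rintro ⟨g, hg, hfg⟩
          rcases List.mem_cons.1 hg with rfl | hg
          · exact absurd hfg har
          · exact ⟨g, hg, hfg⟩
        · rintro ⟨g, hg, hfg⟩; exact ⟨g, List.mem_cons_of_mem _ hg, hfg⟩
      rw [List.map_cons, List.filter_cons_of_neg (by simpa using har), ih]
      exact (if_congr hiff rfl rfl).symm

/-- `capCol7 j` has no repetitions (all `j`). -/
theorem capCol7_nodup' (j : ℕ) : (capCol7 j).Nodup := by
  by_cases hj : j < 400
  · exact capCol7_nodup ⟨j, hj⟩
  · by_cases hj' : j = 400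
    · subst hj'; simp [capCol7, List.nodup_range]
    · simp [capCol7, hj, hj']

/-- `invNonI7` has no repetitions. -/
theorem invNonI7_nodup : invNonI7.Nodup := List.Nodup.filter _ (List.nodup_range)

/-- Membership in `invNonI7`. -/
theorem mem_invNonI7 {g : ℕ} : g ∈ invNonI7 ↔ g < 400 ∧ isInv7 g = true ∧ g ≠ 58 := by
  simp [invNonI7, List.mem_filter, List.mem_range]

set_option maxRecDepth 100000 in
/-- **The coefficient matrix of `xcapSys7s s`.** -/
theorem xcapSys7s_A (s r j : ℕ) : (xcapSys7s s).A r j =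
    (if r ∈ capCol7 j then (1 : ℤ) else 0) +
      (if j = 58 then (if 1274 ≤ r ∧ (r - 1274 < 400 ∧ isInv7 (r - 1274) = true ∧ r - 1274 ≠ 58) then (-1 : ℤ) else 0)
      else if j < 400 ∧ isInv7 j = true then (if r = 1274 + j then (1 : ℤ) else 0) else 0) := by
  have e0 : (xcapSys7s s).A r j = ((((capCol7 j).map fun g => (g, (1 : ℤ))) ++ symCol7 j).filter (fun e => e.1 = r)
      |>.map (·.2)).sum := by
    unfold BoxCert.System.A; rw [foldr_snd_eq_sum]; rfl
  rw [e0, List.filter_append, List.map_append, List.sum_append]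
  congr 1
  · have h := sum_filter_map_pair _ (capCol7_nodup' j) id Function.injective_id 1 r
    simp only [id] at h
    rw [h]
    exact if_congr ⟨fun ⟨g, hg, hgr⟩ => hgr ▸ hg, fun hr => ⟨r, hr, rfl⟩⟩ rfl rfl
  · unfold symCol7
    have hinj : Function.Injective (fun g : ℕ => 1274 + g) := fun a b h => by simpa using h
    by_cases h58 : j = 58
    · rw [if_pos h58, if_pos h58, sum_filter_map_pair _ invNonI7_nodup _ hinj (-1) r]
      refine if_congr ⟨?_, ?_⟩ rfl rfl
      · rintro ⟨g, hg, hgr⟩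
        have e : r - 1274 = g := by omega
        rw [e]
        exact ⟨by omega, mem_invNonI7.1 hg⟩
      · rintro ⟨hle, hm⟩
        exact ⟨r - 1274, mem_invNonI7.2 hm, by omega⟩
    · rw [if_neg h58, if_neg h58]
      by_cases hinv : j < 400 ∧ isInv7 j = true
      · rw [if_pos hinv, if_pos hinv]
        have := sum_filter_map_pair [j] (List.nodup_singleton j) _ hinj 1 r
        simp only [List.map_cons, List.map_nil] at this
        rw [this]
        by_cases hr : r = 1274 + j
        · rw [if_pos ⟨j, by simp, hr.symm⟩, if_pos hr]
        · rw [if_neg, if_neg hr]; rintro ⟨g, hg, hgr⟩; simp at hg; subst hg; exact hr hgr.symm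
      · rw [if_neg hinv, if_neg hinv]; simp

/-- Below the WLOG block the WLOG part of `A r j` vanishes. -/
theorem xcapSys7s_A_lo (s : ℕ) {r : ℕ} (hr : r < 1274) (j : ℕ) : (xcapSys7s s).A r j = (if r ∈ capCol7 j then (1 : ℤ) else 0) := by
  rw [xcapSys7s_A]
  have h0 : (if j = 58 then (if 1274 ≤ r ∧ (r - 1274 < 400 ∧ isInv7 (r - 1274) = true ∧ r - 1274 ≠ 58) then (-1 : ℤ) else 0)
      else if j < 400 ∧ isInv7 j = true then (if r = 1274 + j then (1 : ℤ) else 0) else 0) = 0 := by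
    by_cases h58 : j = 58
    · rw [if_pos h58, if_neg]
      rintro ⟨h, -⟩; omega
    · rw [if_neg h58]
      by_cases hi : j < 400 ∧ isInv7 j = true
      · rw [if_pos hi, if_neg]; omega
      · rw [if_neg hi]
  rw [h0, add_zero]

/-- In the WLOG block the cap part of `A r j` vanishes. -/
theorem xcapSys7s_A_hi (s : ℕ) {r : ℕ} (hr : 1274 ≤ r) (j : ℕ) : (xcapSys7s s).A r j =
    (if j = 58 then (if 1274 ≤ r ∧ (r - 1274 < 400 ∧ isInv7 (r - 1274) = true ∧ r - 1274 ≠ 58) then (-1 : ℤ) else 0)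
      else if j < 400 ∧ isInv7 j = true then (if r = 1274 + j then (1 : ℤ) else 0) else 0) := by
  rw [xcapSys7s_A, if_neg, zero_add]
  intro h; have := lt_of_mem_capCol7 h; omega

variable {ι : Type*} [Fintype ι]

/-- The class counts add up to the number of forms. -/
theorem sum_xcount7 (u : ι → Fin 2 × Fin 2 → ZMod 7) :
    ∑ j ∈ range 401, (univ.filter fun t => xvar7 (u t) = j).card = Fintype.card ι := by
  classical
  rw [← Finset.card_univ, Finset.card_eq_sum_card_fiberwise (f := fun t => xvar7 (u t)) (s := Finset.univ) (t := range 401)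
    (fun t _ => mem_range.2 (xvar7_lt (u t)))]

/-- Counting through a cap row: `∑_j [r ∈ capCol7 j] · x_j = #{t : r ∈ capCol7 (xvar7 (u t))}` for the class counts `x`. -/
theorem sum_capA7_xcount7 (u : ι → Fin 2 × Fin 2 → ZMod 7) (r : ℕ) :
    ∑ j ∈ range 401, (if r ∈ capCol7 j then (1 : ℤ) else 0) * ((univ.filter fun t => xvar7 (u t) = j).card : ℤ)
      = ((univ.filter fun t => r ∈ capCol7 (xvar7 (u t))).card : ℤ) := by
  classical
  rw [Finset.card_eq_sum_card_fiberwise (f := fun t => xvar7 (u t)) (s := univ.filter fun t => r ∈ capCol7 (xvar7 (u t)))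
    (t := range 401) (fun t _ => mem_range.2 (xvar7_lt (u t)))]
  push_cast
  refine sum_congr rfl fun j _ => ?_
  by_cases h : r ∈ capCol7 j
  · rw [if_pos h, one_mul]
    congr 2
    ext t
    simp only [mem_filter, mem_univ, true_and]
    constructor
    · intro ht; exact ⟨by rw [ht]; exact h, ht⟩
    · intro ht; exact ht.2
  · rw [if_neg h, zero_mul]
    symm
    rw [Nat.cast_eq_zero, Finset.card_eq_zero, Finset.filter_eq_empty_iff]
    intro t ht
    rw [mem_filter] at ht
    intro hj
    rw [hj] at ht
    exact h ht.2

variable [DecidableEq ι]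

/-- Cap rows: at most `|ι| − 3n` forms lie on (are listed for) a capped row `r < 1266`. -/
theorem card_capCol7_cap_le {n : ℕ} (β : BilinComp (mulBilin (ZMod 7) 2 2 n) ι) (u : ι → Fin 2 × Fin 2 → ZMod 7)
    (hA : ∀ i x, β.f i x = dotX (u i) x) {r : ℕ} (hr : r < 1266) :
    3 * n + (univ.filter fun t => r ∈ capCol7 (xvar7 (u t))).card ≤ Fintype.card ι := by
  classical
  by_cases hJ : r < 384
  · refine (jPlane7 ⟨r, hJ⟩).three_mul_add_card_le β u hA (fun t => r ∈ capCol7 (xvar7 (u t))) fun t ht => ?_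
    have h := capMem7_of_mem_capCol7 (u t) ht
    unfold capMem7 at h
    rw [dif_pos hJ] at h
    exact perpJ7_dotX h
  · have hl : r - 384 < 882 := by omega
    refine (qPlane7 ⟨r - 384, hl⟩).three_mul_add_card_le zmod7_sq_ne β u hA (fun t => r ∈ capCol7 (xvar7 (u t))) fun t ht => ?_
    have h := capMem7_of_mem_capCol7 (u t) ht
    unfold capMem7 at h
    rw [dif_neg hJ, dif_pos hr] at h
    exact perpQ7_dotX h

omit [DecidableEq ι] in
/-- Row-plane rows: at most `2|ι| − 6n` forms are listed for row `1266 ≤ r < 1274`. -/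
theorem card_capCol7_row_le {n : ℕ} (β : BilinComp (mulBilin (ZMod 7) 2 2 n) ι) (u : ι → Fin 2 × Fin 2 → ZMod 7)
    (hA : ∀ i x, β.f i x = dotX (u i) x) {r : ℕ} (h1 : 1266 ≤ r) (h2 : r < 1274) :
    (univ.filter fun t => r ∈ capCol7 (xvar7 (u t))).card + 6 * n ≤ 2 * Fintype.card ι := by
  classical
  have h := card_vanishing_le_two_mul_sub (n := n) (le_refl 2) β (p1rep_ne_zero (lamIdx7 (r - 1266)))
    (univ.filter fun t => p1rep (lamIdx7 (r - 1266)) ᵥ* xMat (u t) = 0)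
    (fun t ht z => by
      rw [mem_filter] at ht
      rw [hA, dotX_vecMulVec_eq, ht.2, zero_dotProduct])
  refine le_trans (Nat.add_le_add_right (Finset.card_le_card fun t ht => ?_) _) h
  simp only [mem_filter, mem_univ, true_and] at ht ⊢
  have hm := capMem7_of_mem_capCol7 (u t) ht
  unfold capMem7 at hm
  rw [dif_neg (by omega), dif_neg (by omega), if_pos h2] at hm
  exact of_decide_eq_true hm

set_option maxRecDepth 100000 in
/-- **Core of the `𝔽₇` kernel replay.** If some certificate passes for `xcapSys7s s` (denominator `D`, target `T`, box `[0, s]`),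
then every computation of `⟨2,2,n⟩` over `𝔽₇` with `|ι| ≤ 3n + s` products whose X-form class counts satisfy the WLOG inequalities
`x_g ≤ x_58` (`g` invertible) has `|ι| < T`. -/
theorem card_lt_of_cert7 {s D T : ℕ} (c : BoxCert.Cert) (hc : c.check (xcapSys7s s) D T s [] = true)
    {n : ℕ} (hι : Fintype.card ι ≤ 3 * n + s)
    (β : BilinComp (mulBilin (ZMod 7) 2 2 n) ι) (u : ι → Fin 2 × Fin 2 → ZMod 7) (hA : ∀ i x, β.f i x = dotX (u i) x)
    (hW : ∀ g, isInv7 g = true → (univ.filter fun t => xvar7 (u t) = g).card ≤ (univ.filter fun t => xvar7 (u t) = 58).card) :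
    Fintype.card ι < T := by
  classical
  set x : ℕ → ℕ := fun j => (univ.filter fun t => xvar7 (u t) = j).card with hx
  have hcap : ∀ r < 1266, (univ.filter fun t => r ∈ capCol7 (xvar7 (u t))).card ≤ s := by
    intro r hr; have := card_capCol7_cap_le β u hA hr; omega
  -- box
  have hbox : ∀ j, x j ≤ s := by
    intro j
    by_cases hj : j < 400
    · obtain ⟨r, hr, hr'⟩ := capCol7_capped ⟨j, hj⟩
      refine le_trans ?_ (hcap r hr')
      refine Finset.card_le_card fun t ht => ?_
      simp only [mem_filter, mem_univ, true_and] at ht ⊢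
      rw [ht]; exact hr
    · by_cases hj' : j = 400
      · subst hj'
        refine le_trans ?_ (hcap 0 (by norm_num))
        refine Finset.card_le_card fun t ht => ?_
        simp only [mem_filter, mem_univ, true_and] at ht ⊢
        rw [ht]; simp [capCol7]
      · have : x j = 0 := by
          simp only [hx, Finset.card_eq_zero, Finset.filter_eq_empty_iff]
          intro t _ ht
          have := xvar7_lt (u t); omega
        omega
  -- feasibility
  have hfeas : (xcapSys7s s).Feasible x := by
    intro r hr
    change r < 1674 at hr
    show ∑ j ∈ range 401, (xcapSys7s s).A r j * (x j : ℤ) ≤ rhs7s s r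
    by_cases h1274 : r < 1274
    · have eA : ∀ j ∈ range 401, (xcapSys7s s).A r j * (x j : ℤ)
          = (if r ∈ capCol7 j then (1 : ℤ) else 0) * ((univ.filter fun t => xvar7 (u t) = j).card : ℤ) := by
        intro j _; rw [xcapSys7s_A_lo s h1274]
      rw [sum_congr rfl eA, sum_capA7_xcount7]
      by_cases h1266 : r < 1266
      · have : rhs7s s r = s := by simp [rhs7s, h1266]
        rw [this]; exact_mod_cast hcap r h1266
      · have : rhs7s s r = 2 * (s : ℤ) := by simp [rhs7s, h1266, h1274]
        rw [this]
        have h := card_capCol7_row_le β u hA (not_lt.1 h1266) h1274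
        have h2 : (univ.filter fun t => r ∈ capCol7 (xvar7 (u t))).card ≤ 2 * s := by omega
        exact_mod_cast h2
    · have h1274' : 1274 ≤ r := not_lt.1 h1274
      have : rhs7s s r = 0 := by simp [rhs7s]; omega
      rw [this]
      set g := r - 1274 with hg
      have hrg : r = 1274 + g := by omega
      -- split the WLOG part into its `j = 58` and `j = g` pieces
      have eS : ∀ j ∈ range 401, (xcapSys7s s).A r j * (x j : ℤ)
          = (if j = 58 then (if (g < 400 ∧ isInv7 g = true ∧ g ≠ 58) then -(x 58 : ℤ) else 0) else 0)
            + (if j = g then (if (g < 400 ∧ isInv7 g = true ∧ g ≠ 58) then (x g : ℤ) else 0) else 0) := by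
        intro j _
        rw [xcapSys7s_A_hi s h1274']
        by_cases h58 : j = 58
        · subst h58
          rw [if_pos rfl, if_pos rfl]
          by_cases hP : g < 400 ∧ isInv7 g = true ∧ g ≠ 58
          · rw [if_pos ⟨h1274', hP⟩, if_pos hP, if_neg (fun h => hP.2.2 h.symm)]; ring
          · rw [if_neg (fun h => hP h.2), if_neg hP]
            split_ifs <;> ring
        · rw [if_neg h58, if_neg h58, zero_add]
          by_cases hjg : j = g
          · rw [if_pos hjg]
            by_cases hinv : j < 400 ∧ isInv7 j = true
            · have hP : g < 400 ∧ isInv7 g = true ∧ g ≠ 58 := by rw [← hjg]; exact ⟨hinv.1, hinv.2, h58⟩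
              rw [if_pos hinv, if_pos (by omega : r = 1274 + j), if_pos hP, one_mul, hjg]
            · have hP : ¬ (g < 400 ∧ isInv7 g = true ∧ g ≠ 58) := fun h => hinv (by rw [hjg]; exact ⟨h.1, h.2.1⟩)
              rw [if_neg hinv, if_neg hP, zero_mul]
          · rw [if_neg hjg]
            split_ifs with hinv hr2
            · exact absurd (by omega : j = g) hjg
            · ring
            · ring
      rw [sum_congr rfl eS, sum_add_distrib, sum_ite_eq' (range 401), sum_ite_eq' (range 401),
        if_pos (show (58 : ℕ) ∈ range 401 from mem_range.2 (by norm_num))]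
      by_cases hP : g < 400 ∧ isInv7 g = true ∧ g ≠ 58
      · rw [if_pos hP, if_pos (mem_range.2 (by omega)), if_pos hP]
        have h1 := hW g hP.2.1
        have h2 : (x g : ℤ) ≤ (x 58 : ℤ) := by exact_mod_cast h1
        linarith
      · rw [if_neg hP]
        split_ifs <;> simp
  -- the certificate
  have hlt := BoxCert.Cert.sum_lt_of_check_root (xcapSys7s s) (xcapSys7s_colWF s) c hc x hbox hfeas
  change ∑ j ∈ range 401, (univ.filter fun t => xvar7 (u t) = j).card < T at hlt
  rw [sum_xcount7] at hlt
  exact hlt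

end Summit.MatrixMultiplication.OmegaCensus.SmallFormats
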